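import Literature.Computability.QuantumComplexity.ConeSimLoop
import Literature.Computability.Complexity.FoldBricks
import Literature.Computability.Complexity.BinarySubtraction
import HarnessLib

/-!
# The cone simulator, III: the prefix-window front end (description, filter, window labels)

Topic `Literature/Computability/QuantumComplexity`, continuing `ConeSimLoop.lean` (`simCoreF`: the
window-agnostic core — gate loop, statistic, verdict — on `⟨⟨ŷ, table₀⟩, codes⟩`) and
`ConeSimModel.lean` (`winLabs`, `winBits`: the labels agreeing with the input label `x 0^m` from
position `k` on). For the identity wire ordering of
`Literature.Barriers.QuantumAdvantage.markovShi2008_cor15` the light cone of wire `0` of a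
`q`-local circuit of depth `≤ c log₂ n + c` lives on the wires `< K₀`,
`K₀ = qc (|bin n| + 1) + 1` (`LightCone.cone_window`), so the front end is:

* from the input `x`: the description `d = ⟨bin n, ⟨1^m, codes⟩⟩` of the `|x|`-th circuit
  (`QCircuitFamily.descFn`, in `FP` for a uniform family), the input label `w₀ = x 0^m`, the
  unary window bound `1^{K₀}` (`kKF`), `1^{k}` with `k = min K₀ N` (`kkF`), the suffix `w₀ ⇂ k`,
  the numeral `bin K₀`, and a yardstick `ŷ = 1^{Y(|⟨x, d⟩|)}` for a polynomial `Y` (parameter);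
* the **filter** of the gate codes by "both wire numerals `< K₀`" (two folds: reverse, then keep;
  `filtCodesF_value`: `encList` of the codes of the gates with all wires `< K₀`, in order);
* the **initial table** (`tbl0F`): a counted loop over `j < 2^k` consing the items
  `⟨(bin j ++ 0^k) ↾ k ++ sfx, [label = w₀]⟩ = ⟨winBits k w₀ j, dpInit⟩` (`natBits_eq_take`), i.e.
  the table of `dpInit w₀` over `winLabs k w₀` (`tbl0F_value`, needs `2^k ≤ |ŷ|`);
* the assembled decider `deciderF q c Y F = simCoreF ∘ ⟨⟨ŷ, table₀⟩, filtered codes⟩`,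
  `deciderF_mem_FP` (uniform `F`) and `deciderF_eq_coreF` (its argument on every input `x`, for an
  oracle-free `F`).

## References

* S. Arora, B. Barak, *Computational Complexity: A Modern Approach*, CUP 2009, §6.1–6.2
  (descriptions of circuits and uniform families), §1.3.
* I. L. Markov, Y. Shi, *Simulating quantum computation by contracting tensor networks*, SIAM J.
  Comput. 38 (2008), §1 (Cor. 1.5) and §5 ("`r = O(qD)`").
-/

noncomputable section

namespace Literature.Computability.QuantumComplexity

namespace ConeSim

open _root_.Computability Polynomial Complexity Complexity.Brick Cryptography ZW ZWCode ADH

attribute [-simp] Brick.nthF_zero Brick.sndPow_zero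

variable {N : ℕ}

/-! ### Pieces read off the input -/

section Front

variable (q c : ℕ) (pY : Polynomial ℕ) (F : QCircuitFamily cliffordT)

/-- The binary numeral `bin n` of the input length (first field of the description). [folklore] -/
def binNF : List Bool → List Bool := fstF ∘ F.descFn
/-- The unary ancilla count `1^m`. [folklore] -/
def ancUF : List Bool → List Bool := fstF ∘ sndF ∘ F.descFn
/-- The coded list of gate codes. [folklore] -/
def gateCodesF : List Bool → List Bool := sndF ∘ sndF ∘ F.descFn
/-- The input label `w₀ = x 0^m`. [folklore] -/
def inLabF : List Bool → List Bool := OracleCompose.concatFn ∘ fanoutFn id (Kannan.zerosFn ∘ ancUF F)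
/-- **The unary window bound `1^{K₀}`**, `K₀ = qc (|bin n| + 1) + 1`. [cite: MarkovShi2008, §5 (r = O(qD))] -/
def kKF : List Bool → List Bool := Plumb.polyFn (Polynomial.C (q * c) * (X + 1) + 1) ∘ binNF F
/-- `1^k`, `k = min K₀ N`. [folklore] -/
def kkF : List Bool → List Bool := Plumb.takeFn ∘ fanoutFn (inLabF F) (kKF q c F)
/-- The suffix `w₀ ⇂ k` shared by all window labels. [folklore] -/
def sfxF : List Bool → List Bool := Plumb.dropFn ∘ fanoutFn (kkF q c F) (inLabF F)
/-- The numeral `bin K₀`. [folklore] -/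
def binKF : List Bool → List Bool := lenBinF ∘ kKF q c F
/-- **The yardstick** `1^{Y(|⟨x, d⟩|)}`. [folklore] -/
def ydF : List Bool → List Bool := Plumb.polyFn pY ∘ fanoutFn id F.descFn

variable {F}

/-- `binNF ∈ FP` for a uniform family. [folklore] -/
theorem binNF_mem_FP (hU : F.IsUniform) : binNF F ∈ FP := comp_mem_FP fstF_mem_FP (QCircuitFamily.descFn_mem_FP_of_isUniform hU)
/-- `ancUF ∈ FP`. [folklore] -/
theorem ancUF_mem_FP (hU : F.IsUniform) : ancUF F ∈ FP :=
  comp_mem_FP fstF_mem_FP (comp_mem_FP sndF_mem_FP (QCircuitFamily.descFn_mem_FP_of_isUniform hU))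
/-- `gateCodesF ∈ FP`. [folklore] -/
theorem codesF_mem_FP (hU : F.IsUniform) : gateCodesF F ∈ FP :=
  comp_mem_FP sndF_mem_FP (comp_mem_FP sndF_mem_FP (QCircuitFamily.descFn_mem_FP_of_isUniform hU))
/-- `inLabF ∈ FP`. [folklore] -/
theorem inLabF_mem_FP (hU : F.IsUniform) : inLabF F ∈ FP :=
  comp_mem_FP OracleCompose.concatFn_mem_FP (fanoutFn_mem_FP (PolyTimeComputable.id _) (comp_mem_FP Kannan.zerosFn_mem_FP (ancUF_mem_FP hU)))
/-- `kKF ∈ FP`. [folklore] -/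
theorem kKF_mem_FP (hU : F.IsUniform) : kKF q c F ∈ FP := comp_mem_FP (Plumb.polyFn_mem_FP _) (binNF_mem_FP hU)
/-- `kkF ∈ FP`. [folklore] -/
theorem kkF_mem_FP (hU : F.IsUniform) : kkF q c F ∈ FP :=
  comp_mem_FP Plumb.takeFn_mem_FP (fanoutFn_mem_FP (inLabF_mem_FP hU) (kKF_mem_FP q c hU))
/-- `sfxF ∈ FP`. [folklore] -/
theorem sfxF_mem_FP (hU : F.IsUniform) : sfxF q c F ∈ FP :=
  comp_mem_FP Plumb.dropFn_mem_FP (fanoutFn_mem_FP (kkF_mem_FP q c hU) (inLabF_mem_FP hU))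
/-- `binKF ∈ FP`. [folklore] -/
theorem binKF_mem_FP (hU : F.IsUniform) : binKF q c F ∈ FP := comp_mem_FP lenBinF_mem_FP (kKF_mem_FP q c hU)
/-- `ydF ∈ FP`. [folklore] -/
theorem ydF_mem_FP (hU : F.IsUniform) : ydF pY F ∈ FP :=
  comp_mem_FP (Plumb.polyFn_mem_FP _) (fanoutFn_mem_FP (PolyTimeComputable.id _) (QCircuitFamily.descFn_mem_FP_of_isUniform hU))

variable (F) (x : List Bool)

/-- The window bound of the machine: `K₀ = qc (|bin n| + 1) + 1`. [cite: MarkovShi2008, §5 (r = O(qD))] -/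
def kay0 (n : ℕ) : ℕ := q * c * ((encodeNat n).length + 1) + 1

/-- The number of free positions `k = min K₀ N`. [folklore] -/
def kay : ℕ := min (kay0 q c x.length) (x.length + F.ancillas x.length)

/-- `k ≤ N`. [folklore] -/
theorem kay_le : kay q c F x ≤ x.length + F.ancillas x.length := Nat.min_le_right _ _

/-- Values of the pieces on the input `x`. [folklore] -/
theorem front_values :
    binNF F x = encodeNat x.length ∧ ancUF F x = ones (F.ancillas x.length) ∧
      gateCodesF F x = encList (codes F x) ∧ inLabF F x = List.ofFn (w₀ F x) ∧
      kKF q c F x = ones (kay0 q c x.length) ∧ kkF q c F x = ones (kay q c F x) ∧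
      sfxF q c F x = (List.ofFn (w₀ F x)).drop (kay q c F x) ∧ binKF q c F x = encodeNat (kay0 q c x.length) ∧
      ydF pY F x = ones (pY.eval (boolPair x (F.descFn x)).length) := by
  have hd := descFn_eq F x
  have hb : binNF F x = encodeNat x.length := by simp [binNF, hd]
  have hm : ancUF F x = ones (F.ancillas x.length) := by simp [ancUF, hd]
  have hw : inLabF F x = List.ofFn (w₀ F x) := by simp [inLabF, hm, w₀, ofFn_padInput, ones]
  have hK : kKF q c F x = ones (kay0 q c x.length) := by simp [kKF, hb, kay0]
  have hk : kkF q c F x = ones (kay q c F x) := by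
    rw [kkF, Function.comp_apply, fanoutFn_apply, hw, hK, Plumb.takeFn_boolPair]
    simp [ones, kay, Nat.min_comm]
  refine ⟨hb, hm, by simp [gateCodesF, hd], hw, hK, hk, ?_, ?_, ?_⟩
  · rw [sfxF, Function.comp_apply, fanoutFn_apply, hk, hw, Plumb.dropFn_boolPair]; simp [ones]
  · rw [binKF, Function.comp_apply, hK, lenBinF_apply]; simp [ones]
  · simp [ydF]

/-! ### Filtering the gate codes by the window -/

/-- The first wire numeral of a gate code `0 ⟨op, ⟨ar, ⟨bin i, …⟩⟩⟩`. [cite: AroraBarakCC2009, §6.1] -/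
def iOfF : List Bool → List Bool := fstF ∘ sndF ∘ sndF ∘ List.tail
/-- The second wire numeral of a gate code (`ε`, of value `0`, for one-qubit gates). [cite: AroraBarakCC2009, §6.1] -/
def jOfF : List Bool → List Bool := fstF ∘ sndF ∘ sndF ∘ sndF ∘ List.tail

/-- The step consing every item: reverses a coded list. [folklore] -/
def consStep : List Bool → List Bool := fanoutFn (fstF ∘ sndF) (sndF ∘ sndF)

/-- **The window test** on `⟨⟨bin K₀, …⟩, ⟨code, acc⟩⟩`: both wire numerals `< K₀`. [folklore] -/
def keepT : List Bool → List Bool :=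
  andFn (ltFn ∘ fanoutFn (iOfF ∘ fstF ∘ sndF) (fstF ∘ fstF)) (ltFn ∘ fanoutFn (jOfF ∘ fstF ∘ sndF) (fstF ∘ fstF))

/-- The step keeping the item iff it passes the window test. [folklore] -/
def keepStep : List Bool → List Bool := iteFn keepT consStep (sndF ∘ sndF)

/-- The reversed code list. [folklore] -/
def revCodesF : List Bool → List Bool := foldFn consStep (fun _ => []) ∘ fanoutFn (fun _ => []) (gateCodesF F)

/-- **The filtered code list**: the codes of the gates with all wires `< K₀`, in order.
[cite: MarkovShi2008, §1 (Cor. 1.5)] -/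
def filtCodesF : List Bool → List Bool := foldFn keepStep (fun _ => []) ∘ fanoutFn (binKF q c F) (revCodesF F)

/-- `consStep` has growth `FoldGrowth 2`. [folklore] -/
theorem foldGrowth_consStep : FoldGrowth 2 consStep := fun v => by
  rw [consStep, length_fanoutFn]; simp only [Function.comp_apply]; omega

/-- `keepT` is one-bit. [folklore] -/
theorem oneBit_keepT : OneBit keepT := oneBit_andFn (oneBit_ltFn.comp _) (oneBit_ltFn.comp _)

/-- `keepStep` has growth `FoldGrowth 2`. [folklore] -/
theorem foldGrowth_keepStep : FoldGrowth 2 keepStep := fun v => by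
  rw [keepStep, iteFn_of_oneBit oneBit_keepT]
  split_ifs
  · exact foldGrowth_consStep v
  · simp only [Function.comp_apply]; omega

variable {F}

/-- `revCodesF ∈ FP`. [folklore] -/
theorem revCodesF_mem_FP (hU : F.IsUniform) : revCodesF F ∈ FP :=
  comp_mem_FP (foldFn_mem_FP (fanoutFn_mem_FP (comp_mem_FP fstF_mem_FP sndF_mem_FP) (comp_mem_FP sndF_mem_FP sndF_mem_FP))
    (const_mem_FP _) foldGrowth_consStep) (fanoutFn_mem_FP (const_mem_FP _) (codesF_mem_FP hU))

/-- `keepStep ∈ FP`. [folklore] -/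
theorem keepStep_mem_FP : keepStep ∈ FP := by
  have ht : (List.tail : List Bool → List Bool) ∈ FP := PRelSigma.tail_mem_FP
  have hi : iOfF ∈ FP := comp_mem_FP fstF_mem_FP (comp_mem_FP sndF_mem_FP (comp_mem_FP sndF_mem_FP ht))
  have hj : jOfF ∈ FP := comp_mem_FP fstF_mem_FP (comp_mem_FP sndF_mem_FP (comp_mem_FP sndF_mem_FP (comp_mem_FP sndF_mem_FP ht)))
  have hit : (fstF ∘ sndF : List Bool → List Bool) ∈ FP := comp_mem_FP fstF_mem_FP sndF_mem_FP
  exact iteFn_mem_FP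
    (andFn_mem_FP (comp_mem_FP ltFn_mem_FP (fanoutFn_mem_FP (comp_mem_FP hi hit) (comp_mem_FP fstF_mem_FP fstF_mem_FP)))
      (comp_mem_FP ltFn_mem_FP (fanoutFn_mem_FP (comp_mem_FP hj hit) (comp_mem_FP fstF_mem_FP fstF_mem_FP))))
    (fanoutFn_mem_FP hit (comp_mem_FP sndF_mem_FP sndF_mem_FP)) (comp_mem_FP sndF_mem_FP sndF_mem_FP)

/-- **`filtCodesF ∈ FP`.** [cite: AroraBarakCC2009, §1.3] -/
theorem filtCodesF_mem_FP (hU : F.IsUniform) : filtCodesF q c F ∈ FP :=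
  comp_mem_FP (foldFn_mem_FP keepStep_mem_FP (const_mem_FP _) foldGrowth_keepStep)
    (fanoutFn_mem_FP (binKF_mem_FP q c hU) (revCodesF_mem_FP hU))

/-- **The window predicate on gates**: all wires below `K`. [cite: MarkovShi2008, §1 (Cor. 1.5)] -/
def InWindow (K : ℕ) (g : QGate cliffordT N) : Prop := ∀ i ∈ g.wires, (i : ℕ) < K

/-- The window predicate is decidable. [folklore] -/
instance (K : ℕ) : DecidablePred (InWindow (N := N) K) := fun g => by unfold InWindow; infer_instance

/-- The code-level window test, as a Boolean of the code and the bound numeral. [folklore] -/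
def keepCode (bK code : List Bool) : Bool :=
  decide (bitsToNat (iOfF code) < bitsToNat bK) && decide (bitsToNat (jOfF code) < bitsToNat bK)

/-- `keepT` on a step argument. [folklore] -/
theorem keepT_apply (bK r code acc : List Bool) :
    keepT (boolPair (boolPair bK r) (boolPair code acc)) = [keepCode bK code] := by
  rw [keepT, andFn_apply (b := decide (bitsToNat (iOfF code) < bitsToNat bK)) (b' := decide (bitsToNat (jOfF code) < bitsToNat bK))]
  · rfl
  · simp
  · simp

/-- The window predicate on a placed gate: all placed wires below `K`. [folklore] -/
theorem inWindow_gate_iff (K : ℕ) (op : CliffordTOp) (e : Fin (cliffordT.arity op) ↪ Fin N) :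
    InWindow K (QGate.gate op e) ↔ ∀ t, ((e t : Fin N) : ℕ) < K := by
  simp [InWindow, QGate.wires]

/-- An index of a two-wire placement is `0` or `1`. [folklore] -/
theorem fin_arity_cnot (t : Fin (cliffordT.arity CliffordTOp.CNOT)) : t = (0 : Fin 2) ∨ t = (1 : Fin 2) := by
  rcases t with ⟨v, hv⟩
  have hv' : v < 2 := hv
  interval_cases v
  · exact Or.inl rfl
  · exact Or.inr rfl

/-- **The code-level test is the window predicate** on the code of an oracle-free gate (`K ≥ 1`:
the absent second wire of a one-qubit gate reads as `0 < K`). [cite: AroraBarakCC2009, §6.1] -/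
theorem keepCode_encode {K : ℕ} (hK : 1 ≤ K) (g : QGate cliffordT N) (hg : g.IsOracleFree) :
    keepCode (encodeNat K) g.encode = decide (InWindow K g) := by
  have hnil : fstF ([] : List Bool) = [] := rfl
  have hK' : 0 < K := hK
  cases g with
  | oracle k e => exact absurd hg id
  | gate op e =>
    cases op
    · rw [gateH_eq_hOn e, hOn, encode_gateH]
      simp only [keepCode, iOfF, jOfF, Function.comp_apply, List.tail_cons, fstF_boolPair, sndF_boolPair, hnil,
        bitsToNat_encodeNat, bitsToNat_nil, hK', decide_true, Bool.and_true, decide_eq_decide, inWindow_gate_iff]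
      exact ⟨fun h t => h, fun h => h (0 : Fin 1)⟩
    · rw [gateS_eq_sOn e, sOn, encode_gateS]
      simp only [keepCode, iOfF, jOfF, Function.comp_apply, List.tail_cons, fstF_boolPair, sndF_boolPair, hnil,
        bitsToNat_encodeNat, bitsToNat_nil, hK', decide_true, Bool.and_true, decide_eq_decide, inWindow_gate_iff]
      exact ⟨fun h t => h, fun h => h (0 : Fin 1)⟩
    · rw [show (QGate.gate CliffordTOp.T e : QGate cliffordT N) = QGate.gate CliffordTOp.T (wireEmb (embT e 0)) from
        congrArg _ (emb_one_eq_wireEmb (embT e)), encode_gateT]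
      simp only [keepCode, iOfF, jOfF, Function.comp_apply, List.tail_cons, fstF_boolPair, sndF_boolPair, hnil,
        bitsToNat_encodeNat, bitsToNat_nil, hK', decide_true, Bool.and_true, decide_eq_decide, inWindow_gate_iff]
      exact ⟨fun h t => h, fun h => h (0 : Fin 1)⟩
    · rw [gateCNOT_eq_cnotOn e, cnotOn, encode_gateCNOT]
      simp only [keepCode, iOfF, jOfF, Function.comp_apply, List.tail_cons, fstF_boolPair, sndF_boolPair,
        bitsToNat_encodeNat, ← Bool.decide_and, decide_eq_decide, inWindow_gate_iff]
      refine ⟨fun h t => ?_, fun h => ⟨h (0 : Fin 2), h (1 : Fin 2)⟩⟩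
      rcases fin_arity_cnot t with rfl | rfl
      · exact h.1
      · exact h.2

variable (F)

/-- Value of the reversing fold. [folklore] -/
theorem revCodesF_value : revCodesF F x = encList (codes F x).reverse := by
  have hc : gateCodesF F x = encList (codes F x) := by simp [gateCodesF, descFn_eq F x, codes]
  rw [revCodesF, Function.comp_apply, fanoutFn_apply, hc, foldFn_boolPair, decNil_encList]
  suffices h : ∀ (l acc : List (List Bool)),
      l.foldl (fun acc a => consStep (boolPair (boolPair [] (encList (codes F x))) (boolPair a acc))) (encList acc) =
        encList (l.reverse ++ acc) by
    simpa using h (codes F x) []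
  intro l
  induction l with
  | nil => intro acc; simp
  | cons a l ih =>
    intro acc
    rw [List.foldl_cons, show consStep (boolPair (boolPair [] (encList (codes F x))) (boolPair a (encList acc))) = encList (a :: acc) by
      simp [consStep, encList_cons], ih]
    simp

/-- The keeping step on a step argument. [folklore] -/
theorem keepStep_apply (bK r code : List Bool) (acc : List (List Bool)) :
    keepStep (boolPair (boolPair bK r) (boolPair code (encList acc))) =
      if keepCode bK code then encList (code :: acc) else encList acc := by
  rw [keepStep, iteFn_apply (keepT_apply bK r code (encList acc))]
  cases keepCode bK code
  · rw [if_neg Bool.false_ne_true]; simp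
  · rw [if_pos rfl, if_pos rfl]; simp [consStep, encList_cons]

/-- Value of the keeping fold on a reversed list: the filter, in the original order. [folklore] -/
theorem foldl_keepStep (bK r : List Bool) : ∀ (l acc : List (List Bool)),
    l.foldl (fun acc a => keepStep (boolPair (boolPair bK r) (boolPair a acc))) (encList acc) =
      encList ((l.filter (keepCode bK)).reverse ++ acc)
  | [], acc => by simp
  | a :: l, acc => by
    rw [List.foldl_cons, keepStep_apply, List.filter_cons]
    cases keepCode bK a
    · rw [if_neg Bool.false_ne_true, foldl_keepStep bK r l acc]
      simp
    · rw [if_pos rfl, foldl_keepStep bK r l (a :: acc)]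
      simp

/-- **Value of the filter**: the codes of the gates of the `|x|`-th circuit that act inside the
window, in order (oracle-free family). [cite: MarkovShi2008, §1 (Cor. 1.5)] -/
theorem filtCodesF_value (hF : F.IsOracleFree) :
    filtCodesF q c F x =
      encList ((((F.circ x.length).gates).filter fun g => decide (InWindow (kay0 q c x.length) g)).map QGate.encode) := by
  rw [filtCodesF, Function.comp_apply, fanoutFn_apply, (front_values q c 0 F x).2.2.2.2.2.2.2.1, revCodesF_value F x,
    foldFn_boolPair, decNil_encList]
  have h := foldl_keepStep (encodeNat (kay0 q c x.length)) (encList (codes F x).reverse) (codes F x).reverse []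
  rw [show encList ([] : List (List Bool)) = [] from rfl] at h
  rw [h, List.append_nil, List.filter_reverse, List.reverse_reverse, codes, List.filter_map]
  congr 2
  refine List.filter_congr fun g hg => ?_
  rw [Function.comp_apply, keepCode_encode (by unfold kay0; omega) g (hF x.length g hg)]

/-! ### The initial table over the window labels -/

/-- The context `x̂ = ⟨ŷ, ⟨1^k, ⟨sfx, w₀⟩⟩⟩` of the enumeration loop (its first field clocks it).
[folklore] -/
def xhatF : List Bool → List Bool := fanoutFn (ydF pY F) (fanoutFn (kkF q c F) (fanoutFn (sfxF q c F) (inLabF F)))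

/-- The label of the current counter: `(bin (⟦cnt⟧ − 1) ++ 0^k) ↾ k ++ sfx` (= `winBits k w₀ (⟦cnt⟧ − 1)`, `natBits_eq_take`). [folklore] -/
def labBodyF : List Bool → List Bool :=
  OracleCompose.concatFn ∘ fanoutFn
    (Plumb.takeFn ∘ fanoutFn (nthF 1 ∘ fstF) (OracleCompose.concatFn ∘ fanoutFn predCntF (Kannan.zerosFn ∘ nthF 1 ∘ fstF)))
    (nthF 2 ∘ fstF)

/-- The amplitude of the current label: `1` on `w₀`, else `0`. [folklore] -/
def ampBodyF : List Bool → List Bool :=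
  iteFn (eqPairFn ∘ fanoutFn labBodyF (sndPow 2 ∘ fstF)) (fun _ => enc ZW.one) (fun _ => enc 0)

/-- **The loop body**: cons the item `⟨label, amplitude⟩` onto the state. [folklore] -/
def initBody : List Bool → List Bool := fanoutFn (fanoutFn labBodyF ampBodyF) (sndPow 1)

/-- The initial loop record `⟨x̂, ⟨bin 2^k, ε⟩⟩`. [folklore] -/
def z0F : List Bool → List Bool := fanoutFn (xhatF q c pY F) (fanoutFn (pow2UF ∘ kkF q c F) (fun _ => []))

/-- **The initial table**: `2^k` rounds of the body (clocked by `|x̂| ≥ |ŷ|`). [folklore] -/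
def tbl0F : List Bool → List Bool :=
  sndPow 1 ∘ (fun z => (loopStep initBody)^[(X : Polynomial ℕ).eval (fstF z).length] z) ∘ z0F q c pY F

variable {F}

/-- `labBodyF ∈ FP`. [folklore] -/
theorem labBodyF_mem_FP : labBodyF ∈ FP :=
  comp_mem_FP OracleCompose.concatFn_mem_FP (fanoutFn_mem_FP
    (comp_mem_FP Plumb.takeFn_mem_FP (fanoutFn_mem_FP (comp_mem_FP (nthF_mem_FP 1) fstF_mem_FP)
      (comp_mem_FP OracleCompose.concatFn_mem_FP (fanoutFn_mem_FP predCntF_mem_FP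
        (comp_mem_FP Kannan.zerosFn_mem_FP (comp_mem_FP (nthF_mem_FP 1) fstF_mem_FP))))))
    (comp_mem_FP (nthF_mem_FP 2) fstF_mem_FP))

/-- `ampBodyF ∈ FP`. [folklore] -/
theorem ampBodyF_mem_FP : ampBodyF ∈ FP :=
  iteFn_mem_FP (comp_mem_FP eqPairFn_mem_FP (fanoutFn_mem_FP labBodyF_mem_FP (comp_mem_FP (sndPow_mem_FP 2) fstF_mem_FP)))
    (const_mem_FP _) (const_mem_FP _)

/-- `initBody ∈ FP`. [folklore] -/
theorem initBody_mem_FP : initBody ∈ FP := fanoutFn_mem_FP (fanoutFn_mem_FP labBodyF_mem_FP ampBodyF_mem_FP) (sndPow_mem_FP 1)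

/-- The label of the body is not longer than twice the context. [folklore] -/
theorem length_labBodyF_le (z : List Bool) : (labBodyF z).length ≤ 2 * (fstF z).length := by
  have h1 := length_nthF_le 1 (fstF z)
  have h2 := length_nthF_le 2 (fstF z)
  rw [labBodyF, Function.comp_apply, fanoutFn_apply, OracleCompose.concatFn_boolPair, List.length_append,
    Function.comp_apply, fanoutFn_apply, Plumb.takeFn_boolPair]
  have := List.length_take_le ((nthF 1 ∘ fstF) z).length
    ((OracleCompose.concatFn ∘ fanoutFn predCntF (Kannan.zerosFn ∘ nthF 1 ∘ fstF)) z)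
  simp only [Function.comp_apply] at this ⊢
  omega

/-- The amplitude of the body has at most `34` symbols. [folklore] -/
theorem length_ampBodyF_le (z : List Bool) : (ampBodyF z).length ≤ 34 := by
  have h1 : (enc ZW.one).length ≤ 34 := by
    have := length_enc_le (a := ZW.one) (B := 1) (fun i => by fin_cases i <;> simp [ZW.one])
    omega
  have h0 : (enc (0 : ZW)).length ≤ 34 := by
    have := length_enc_le (a := (0 : ZW)) (B := 1) (fun i => by simp)
    omega
  rw [ampBodyF, iteFn_apply (b := decide (labBodyF z = (sndPow 2 ∘ fstF) z)) (by simp [eqPairFn_boolPair])]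
  split_ifs
  · exact h1
  · exact h0

/-- **Linear growth of the body** in the first field: `≤ |state| + 76 (|x̂| + 1)`. [folklore] -/
theorem length_initBody_le (z : List Bool) : (initBody z).length ≤ (sndPow 1 z).length + 76 * ((fstF z).length + 1) := by
  have h1 := length_labBodyF_le z
  have h2 := length_ampBodyF_le z
  rw [initBody, length_fanoutFn, length_fanoutFn]
  omega

/-- **`tbl0F ∈ FP`** (`loopFn_mem_FP`). [cite: AroraBarakCC2009, §1.3] -/
theorem tbl0F_mem_FP (hU : F.IsUniform) : tbl0F q c pY F ∈ FP := by
  have hx : xhatF q c pY F ∈ FP :=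
    fanoutFn_mem_FP (ydF_mem_FP pY hU) (fanoutFn_mem_FP (kkF_mem_FP q c hU) (fanoutFn_mem_FP (sfxF_mem_FP q c hU) (inLabF_mem_FP hU)))
  have hz : z0F q c pY F ∈ FP := fanoutFn_mem_FP hx (fanoutFn_mem_FP (comp_mem_FP pow2UF_mem_FP (kkF_mem_FP q c hU)) (const_mem_FP _))
  exact comp_mem_FP (sndPow_mem_FP 1) (comp_mem_FP (loopFn_mem_FP initBody_mem_FP length_initBody_le X) hz)

variable (F)

/-- The context on the input `x`. [folklore] -/
def xhat : List Bool :=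
  boolPair (ydF pY F x) (boolPair (ones (kay q c F x)) (boolPair ((List.ofFn (w₀ F x)).drop (kay q c F x)) (List.ofFn (w₀ F x))))

/-- Value of `xhatF`. [folklore] -/
theorem xhatF_value : xhatF q c pY F x = xhat q c pY F x := by
  obtain ⟨-, -, -, hw, -, hk, hs, -, -⟩ := front_values q c pY F x
  rw [xhatF, fanoutFn_apply, fanoutFn_apply, fanoutFn_apply, hk, hs, hw, xhat]

/-- **The body on a genuine record**: item `⟨winBits k w₀ j, code of dpInit⟩` consed. [folklore] -/
theorem initBody_value (j : ℕ) (hj : j < 2 ^ kay q c F x) (s : List Bool) :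
    initBody (boolPair (xhat q c pY F x) (boolPair (encodeNat (j + 1)) s)) =
      boolPair (boolPair (winBits (kay q c F x) (w₀ F x) j)
        (enc (dpInit (w₀ F x) (winLab (kay q c F x) (kay_le q c F x) (w₀ F x) j)))) s := by
  have hx1 : nthF 1 (xhat q c pY F x) = ones (kay q c F x) := by
    simp only [xhat, nthF_succ_boolPair, nthF_zero_boolPair]
  have hx2 : nthF 2 (xhat q c pY F x) = (List.ofFn (w₀ F x)).drop (kay q c F x) := by
    simp only [xhat, nthF_succ_boolPair, nthF_zero_boolPair]
  have hx3 : sndPow 2 (xhat q c pY F x) = List.ofFn (w₀ F x) := by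
    simp only [xhat, sndPow_succ_boolPair, sndPow_zero_boolPair]
  have hlab : labBodyF (boolPair (xhat q c pY F x) (boolPair (encodeNat (j + 1)) s)) = winBits (kay q c F x) (w₀ F x) j := by
    simp only [labBodyF, Function.comp_apply, fanoutFn_apply, fstF_boolPair, hx1, hx2, predCntF_apply, bitsToNat_encodeNat,
      Nat.add_sub_cancel, Kannan.zerosFn_apply, OracleCompose.concatFn_boolPair, Plumb.takeFn_boolPair]
    rw [winBits, natBits_eq_take hj]
    simp [ones]
  have hw0 : (sndPow 2 ∘ fstF) (boolPair (xhat q c pY F x) (boolPair (encodeNat (j + 1)) s)) = List.ofFn (w₀ F x) := by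
    rw [Function.comp_apply, fstF_boolPair, hx3]
  have hamp : ampBodyF (boolPair (xhat q c pY F x) (boolPair (encodeNat (j + 1)) s)) =
      enc (dpInit (w₀ F x) (winLab (kay q c F x) (kay_le q c F x) (w₀ F x) j)) := by
    rw [ampBodyF, iteFn_apply (b := decide (labBodyF (boolPair (xhat q c pY F x) (boolPair (encodeNat (j + 1)) s)) =
        (sndPow 2 ∘ fstF) (boolPair (xhat q c pY F x) (boolPair (encodeNat (j + 1)) s))))
        (by rw [Function.comp_apply, fanoutFn_apply, eqPairFn_boolPair]),
      hlab, hw0, dpInit]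
    have he : (winBits (kay q c F x) (w₀ F x) j = List.ofFn (w₀ F x)) ↔ winLab (kay q c F x) (kay_le q c F x) (w₀ F x) j = w₀ F x := by
      rw [← ofFn_winLab (kay_le q c F x), List.ofFn_inj]
    by_cases h : winLab (kay q c F x) (kay_le q c F x) (w₀ F x) j = w₀ F x
    · rw [decide_eq_true (he.2 h), if_pos rfl, if_pos h]
    · rw [decide_eq_false (mt he.1 h), if_neg Bool.false_ne_true, if_neg h]
  rw [initBody, fanoutFn_apply, fanoutFn_apply, hlab, hamp]
  simp only [sndPow_succ_boolPair, sndPow_zero_boolPair]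

/-- The initial table as a list: the table of `dpInit w₀` over the window labels. [folklore] -/
def tbl0 : List (QReg (x.length + F.ancillas x.length) × ZW) :=
  (winLabs (kay q c F x) (kay_le q c F x) (w₀ F x)).map fun z => (z, dpInit (w₀ F x) z)

/-- The loop model of the body enumerates the window labels below the counter. [folklore] -/
theorem loopModel_initBody : ∀ (L : ℕ), L ≤ 2 ^ kay q c F x → ∀ (acc : List (QReg (x.length + F.ancillas x.length) × ZW)),
    loopModel initBody (xhat q c pY F x) L (tableEnc acc) =
      tableEnc (((List.range L).map fun j => (winLab (kay q c F x) (kay_le q c F x) (w₀ F x) j,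
        dpInit (w₀ F x) (winLab (kay q c F x) (kay_le q c F x) (w₀ F x) j))) ++ acc)
  | 0, _, acc => by simp [loopModel]
  | L + 1, hL, acc => by
    rw [loopModel, initBody_value q c pY F x L (by omega),
      show boolPair (boolPair (winBits (kay q c F x) (w₀ F x) L)
          (enc (dpInit (w₀ F x) (winLab (kay q c F x) (kay_le q c F x) (w₀ F x) L)))) (tableEnc acc) =
        tableEnc ((winLab (kay q c F x) (kay_le q c F x) (w₀ F x) L, dpInit (w₀ F x) (winLab (kay q c F x) (kay_le q c F x) (w₀ F x) L)) :: acc) by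
        rw [tableEnc_cons, itemEnc, ofFn_winLab],
      loopModel_initBody L (by omega)]
    rw [List.range_succ, List.map_append, List.map_singleton, List.append_assoc, List.singleton_append]

/-- **Value of the initial table** (needs `2^k ≤ |ŷ|` rounds). [cite: NielsenChuang2010, §4.5.5] -/
theorem tbl0F_value (hY : 2 ^ kay q c F x ≤ (ydF pY F x).length) : tbl0F q c pY F x = tableEnc (tbl0 q c F x) := by
  obtain ⟨-, -, -, -, -, hk, -, -, -⟩ := front_values q c pY F x
  have hcnt : pow2UF (ones (kay q c F x)) = encodeNat (2 ^ kay q c F x) := by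
    have h1 : bitsToNat (pow2UF (ones (kay q c F x))) = 2 ^ kay q c F x := by
      rw [bitsToNat_pow2F]; simp [ones]
    have hcan : IsCanonicalNum (pow2UF (ones (kay q c F x))) := by
      simp only [pow2UF, Function.comp_apply, fanoutFn_apply, OracleCompose.concatFn_boolPair]
      exact isCanonicalNum_append_true _
    rw [← h1, encodeNat_bitsToNat hcan]
  have hz : z0F q c pY F x = boolPair (xhat q c pY F x) (boolPair (encodeNat (2 ^ kay q c F x)) []) := by
    rw [z0F, fanoutFn_apply, fanoutFn_apply, xhatF_value, Function.comp_apply, hk, hcnt]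
  have hrounds : 2 ^ kay q c F x ≤
      (X : Polynomial ℕ).eval (fstF (boolPair (xhat q c pY F x) (boolPair (encodeNat (2 ^ kay q c F x)) []))).length := by
    rw [fstF_boolPair, eval_X, xhat, length_boolPair]
    omega
  rw [tbl0F, Function.comp_apply, Function.comp_apply, hz, iterate_loopStep initBody _ _ _ [] hrounds,
    show ([] : List Bool) = tableEnc ([] : List (QReg (x.length + F.ancillas x.length) × ZW)) from rfl,
    loopModel_initBody q c pY F x _ le_rfl, sndPow_succ_boolPair, sndPow_zero_boolPair, List.append_nil, tbl0, winLabs, List.map_map]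
  rfl

/-! ### The decider -/

/-- The argument `⟨⟨ŷ, table₀⟩, filtered codes⟩` of the core. [folklore] -/
def simCoreArgF : List Bool → List Bool := fanoutFn (fanoutFn (ydF pY F) (tbl0F q c pY F)) (filtCodesF q c F)

/-- **The decider of the prefix-window simulator.** [cite: MarkovShi2008, §1 (Cor. 1.5)] -/
def deciderF : List Bool → List Bool := simCoreF ∘ simCoreArgF q c pY F

variable {F}

/-- **`deciderF ∈ FP`** for a uniform family. [cite: AroraBarakCC2009, §1.3] -/
theorem deciderF_mem_FP (hU : F.IsUniform) : deciderF q c pY F ∈ FP :=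
  comp_mem_FP simCoreF_mem_FP (fanoutFn_mem_FP (fanoutFn_mem_FP (ydF_mem_FP pY hU) (tbl0F_mem_FP q c pY hU)) (filtCodesF_mem_FP q c hU))

/-- The decider is one-bit. [folklore] -/
theorem oneBit_deciderF : OneBit (deciderF q c pY F) := oneBit_coreF.comp _

/-- **The decider's core argument on an input** (oracle-free family, enough rounds).
[cite: MarkovShi2008, §1 (Cor. 1.5)] -/
theorem deciderF_eq_coreF (hF : F.IsOracleFree) (hY : 2 ^ kay q c F x ≤ (ydF pY F x).length) :
    deciderF q c pY F x =
      simCoreF (boolPair (boolPair (ydF pY F x) (tableEnc (tbl0 q c F x)))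
        (encList ((((F.circ x.length).gates).filter fun g => decide (InWindow (kay0 q c x.length) g)).map QGate.encode))) := by
  rw [deciderF, Function.comp_apply, simCoreArgF, fanoutFn_apply, fanoutFn_apply, tbl0F_value q c pY F x hY,
    filtCodesF_value q c F x hF]

end Front

end ConeSim

end Literature.Computability.QuantumComplexity

end
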